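import Summits.BirchSwinnertonDyer.BirchSwinnertonDyer.Theorems.AlignedTransportAtTwoMainConjectureOfRankZeroBSDAtTwoCubicDepthDoorOddIndex
import Summits.BirchSwinnertonDyer.BirchSwinnertonDyer.Theorems.AlignedTransportAtTwoMainConjectureOfRankZeroBSDAtTwoCubicLayerOneDoors
import Literature.NumberTheory.IwasawaTheory.ClassNumberPExpLayerOneEqOneOfGenusCertificate
import HarnessLib

/-!
# Route `AlignedTransportAtTwo`, crux C2 `MainConjectureOfRankZeroBSDAtTwo` (stmt-BirchSwinnertonDyer-22298):
# THE DEPTH DOOR WITH ITS SEXTIC DATUM DISCHARGED — on `Δ_min ≡ 5 (mod 8)`, `ord₂ h(ℚ(β,√2)) ≤ 1` follows from a GENUS-CHARACTER CERTIFICATE in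
# `𝓞_{ℚ(β)}`: a prime `𝔭₁` of norm `2`, a unit `ε ≡ ±1 (mod 𝔭₁³)` of odd index, and a dyadic prime power `𝔭₂^k = (π)` with `π ≡ ±3 (mod 𝔭₁³)`

HONEST FRAMING (cell `bsd-f1-sign2`, WIDTH-5 attached prover seat `bsd-line-att-p3` gen 43 on line `birth` of the lead `bsd-line-att-p2`;
`--supports` stmt-BirchSwinnertonDyer-22298, closes nothing; BSD is NOT proved by any of this; the crux C2, its verdict «blocked-on
`Rank1Residual.GreenbergMuConjectureIrreducible`» and every registered stub are untouched).  THEOREMS ONLY — no definition, no named fact, no `sorry`.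
Sequel of att-p3 g42's `…CubicDepthDoorOddIndex` (the depth door with displayed `h(ℚ(β))` odd, `ord₂ h(K_1) ≤ 1`, unit norm index `1`).

WHY / WHAT.  Of the three displayed data of the depth door, `ord₂ h(K_1) ≤ 1` (`K_1 = ℚ(β,√2)`, a SEXTIC class number) was the one without a kernel path
(g42 memo §6 (iv): «the real bottleneck of every door on this sub-cell»).  This seat's Literature theorem
`IwasawaTheory.classNumberPExp_one_eq_one_of_genusCert_of_rank_eq_one` (genus theory for `K_1/ℚ(β)`, ELEMENTARY direction only: the dyadic Hilbert symbol at
`𝔭₁` is a genus character killing the would-be square root of the ambiguous class `[𝔓₂]`) computes `ord₂ h(K_1) = 1` from data of the CUBIC field alone.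
Hence, for `W` globally minimal, good ordinary at `2`, no rational `2`-torsion abscissa, `Δ_min ≡ 5 (mod 8)` (two primes above `2`: `𝔭₁` of degree `1`,
`𝔭₂` of degree `2`), `Δ_W < 0` (unit rank `1`):
* **`classGroupPRank_le_one_adjoin_of_depthDoor_of_genusCert`** — displayed: `h(ℚ(β))` odd, `2 ∤ d_{ℚ(β)}`, an ideal `𝔭₁` of norm `2`, a unit `ε ≡ ±1 (mod 𝔭₁³)`
  with `±ε` non-squares, a prime `𝔭₂ ∋ 2` with `𝔭₂^k = (π)`, `π ≡ ±3 (mod 𝔭₁³)`, and `[E : E ∩ N_{K_2/ℚ(β)} K_2ˣ] = 1` ⟹ `rank₂ Cl(K_m) ≤ 1 ∀ m`, `μ₂ = 0`, `λ₂ ≤ 1`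
  for the cyclotomic `κ` of `ℚ(β)` — and `e₁(κ) = 1` (`classNumberPExp_one_adjoin_eq_one_of_genusCert`);
* **`mazurMainConjecture_two_of_muIneqRel_of_depthDoor_of_genusCert`** — PRINT⁵ + MuIneqʳ + the cell hypotheses + the same certificate + the unit norm
  index for every cyclotomic `κ` ⟹ `MC₂(W)`.
On the census classes u1/u7 (`σ₁(ε) ≡ ±1 (mod 8)`) the unit congruence holds by definition; `π ≡ ±3 (mod 𝔭₁³)` is the kernel form of att-p3 g41's predictor
«`σ₁(π₁)/2 ≡ ±3 (mod 8)`»; the ONLY displayed datum left outside `𝓞_{ℚ(β)}` is the unit norm index of the quartic layer (two norm identities in `ℚ(β,θ)`).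

CONDITIONAL theorems (PRINT⁵, MuIneqʳ displayed); nothing is asserted about any seed; nothing is closed; BSD is not proved.

References: [Gras2003] IV.4; [Serre1973CourseArithmetic] Ch. III §1.2 Thm. 1; [Washington1997] §13.1 Prop. 13.2, §13.3 Prop. 13.22–13.23; [Lang1990] Ch. 13 §4,
Lemma 4.1; [Fukuda1994] Thm. 1, p. 264; [NeukirchANT1999] Ch. I §7 (7.4), §8 (8.2), Ch. III §1 (1.6); [Kato2004Asterisque] Thm. 17.4 (1)(2) (p. 273);
[GreenbergLNM1716] Thm. 4.1 (p. 102), Conj. 1.11 (p. 58); [Cohen1993] Prop. 4.8.11; tree: att-p3 g42 `…CubicDepthDoor{,OddIndex}`, att-p5 g26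
`…CubicPrimesOfEmbeddings`, `…CubicLayerOneDoors`, this seat's Literature `NumberFields/QuadraticSqrtTwoClassNumberNotDvdFour`,
`IwasawaTheory/ClassNumberPExpLayerOneEqOneOfGenusCertificate`.
-/

set_option linter.dupNamespace false
set_option autoImplicit false

noncomputable section

open scoped Classical NumberField nonZeroDivisors

namespace Summit.BirchSwinnertonDyer.BirchSwinnertonDyer.Theorems.AlignedTransportAtTwoCubicDepthDoorGenusCert

open NumberField IsDedekindDomain Polynomial WeierstrassCurve IntermediateField CongruenceSubgroup
  Literature.NumberTheory.IwasawaTheory Literature.NumberTheory.GaloisRepresentations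
  Literature.NumberTheory.GaloisRepresentations.Herbrand Literature.NumberTheory.GaloisRepresentations.MinkowskiUnit
  Literature.NumberTheory.GaloisRepresentations.CyclicNormIndex
  Literature.NumberTheory.EllipticCurves Literature.NumberTheory.EllipticCurves.Greenberg1999
  Literature.NumberTheory.EllipticCurves.ModularForms
  Literature.NumberTheory.EllipticCurves.Rank1Residual
  Literature.NumberTheory.EllipticCurves.Module
  Summit.BirchSwinnertonDyer.Rank1Residual
  Summit.BirchSwinnertonDyer.Rank1Residual.X1.MuLambda
  Summit.BirchSwinnertonDyer.Rank1Residual.X5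
  Summit.BirchSwinnertonDyer.Rank1Residual.F1Sign2
  Summit.BirchSwinnertonDyer.BirchSwinnertonDyer.Theorems.Rank1ResidualX1Defs
  Summit.BirchSwinnertonDyer.BirchSwinnertonDyer.Theses.AlignedTransportAtTwo
  Summit.BirchSwinnertonDyer.BirchSwinnertonDyer.Theorems.AlignedTransportAtTwoKilfordStratumShared
  Summit.BirchSwinnertonDyer.BirchSwinnertonDyer.Theorems.AlignedTransportAtTwoCubicCarrierRoad
  Summit.BirchSwinnertonDyer.BirchSwinnertonDyer.Theorems.AlignedTransportAtTwoCubicKilfordPrimes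
  Summit.BirchSwinnertonDyer.BirchSwinnertonDyer.Theorems.AlignedTransportAtTwoCubicPrimesOfEmbeddings
  Summit.BirchSwinnertonDyer.BirchSwinnertonDyer.Theorems.AlignedTransportAtTwoCubicOffStratumRamification
  Summit.BirchSwinnertonDyer.BirchSwinnertonDyer.Theorems.AlignedTransportAtTwoCubicDepthDoor
  Summit.BirchSwinnertonDyer.BirchSwinnertonDyer.Theorems.AlignedTransportAtTwoCubicDepthDoorOddIndex
  Summit.BirchSwinnertonDyer.BirchSwinnertonDyer.Theorems.AlignedTransportAtTwoCubicLayerOneDoors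

variable (W : WeierstrassCurve ℚ) [W.IsElliptic] [W.IsGloballyMinimal]

/-! ## §1 `e₁ = 1` for the cubic `2`-torsion field from the certificate -/

/-- **`e₁(κ) = 1` FOR THE CUBIC `2`-TORSION FIELD FROM THE GENUS-CHARACTER CERTIFICATE.**  `W/ℚ` globally minimal, good ordinary at `2`, no rational
`2`-torsion abscissa, `Δ_min ≡ 5 (mod 8)` (exactly two primes of `ℚ(β)` above `2`), `Δ_W < 0` (unit rank `1`), `β ∈ ℚ̄` a root of the `2`-division cubic,
`κ` a cyclotomic `ℤ₂`-extension of `ℚ(β)`; displayed: `h(ℚ(β))` odd, `2 ∤ d_{ℚ(β)}`, an ideal `𝔭₁` of `𝓞_{ℚ(β)}` of norm `2`, a unit `ε ≡ ±1 (mod 𝔭₁³)` such that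
neither `ε` nor `−ε` is the square of a unit, a prime `𝔭₂ ∋ 2` with `𝔭₂^k = (π)` and `π ≡ ±3 (mod 𝔭₁³)`.  THEN `classNumberPExp κ 1 = 1`, i.e.
`ord₂ h(ℚ(β,√2)) = 1`. [cite: Gras2003, IV.4] [cite: Serre1973CourseArithmetic, Ch. III §1.2, Thm. 1] [cite: NeukirchANT1999, Ch. I §7 Thm. (7.4) and Ch. III §1 (1.6)]
[cite: Cohen1993, Prop. 4.8.11] -/
theorem classNumberPExp_one_adjoin_eq_one_of_genusCert (hord : IsOrdinaryAt W 2)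
    (ht : ∀ x : ℚ, ¬ HasRationalTwoTorsionX W x) (h85 : minimalDiscriminantInt W % 8 = 5) (hΔ : W.Δ < 0)
    {β : AlgebraicClosure ℚ} (hβ : aeval β W.twoTorsionPolynomial.toPoly = 0)
    (hh : haveI : FiniteDimensional ℚ ↥(IntermediateField.adjoin ℚ ({β} : Set (AlgebraicClosure ℚ))) :=
        IntermediateField.adjoin.finiteDimensional ((AlgebraicClosure.isAlgebraic ℚ).isAlgebraic β).isIntegral
      haveI : NumberField ↥(IntermediateField.adjoin ℚ ({β} : Set (AlgebraicClosure ℚ))) := NumberField.mk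
      ¬ 2 ∣ classNumber ↥(IntermediateField.adjoin ℚ ({β} : Set (AlgebraicClosure ℚ))))
    (hd : haveI : FiniteDimensional ℚ ↥(IntermediateField.adjoin ℚ ({β} : Set (AlgebraicClosure ℚ))) :=
        IntermediateField.adjoin.finiteDimensional ((AlgebraicClosure.isAlgebraic ℚ).isAlgebraic β).isIntegral
      haveI : NumberField ↥(IntermediateField.adjoin ℚ ({β} : Set (AlgebraicClosure ℚ))) := NumberField.mk
      ¬ (2 : ℤ) ∣ NumberField.discr ↥(IntermediateField.adjoin ℚ ({β} : Set (AlgebraicClosure ℚ))))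
    (𝔭₁ : Ideal (𝓞 ↥(IntermediateField.adjoin ℚ ({β} : Set (AlgebraicClosure ℚ)))))
    (hN : haveI : FiniteDimensional ℚ ↥(IntermediateField.adjoin ℚ ({β} : Set (AlgebraicClosure ℚ))) :=
        IntermediateField.adjoin.finiteDimensional ((AlgebraicClosure.isAlgebraic ℚ).isAlgebraic β).isIntegral
      haveI : NumberField ↥(IntermediateField.adjoin ℚ ({β} : Set (AlgebraicClosure ℚ))) := NumberField.mk
      Ideal.absNorm 𝔭₁ = 2)
    {ε : (𝓞 ↥(IntermediateField.adjoin ℚ ({β} : Set (AlgebraicClosure ℚ))))ˣ}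
    (hε : (ε : 𝓞 ↥(IntermediateField.adjoin ℚ ({β} : Set (AlgebraicClosure ℚ)))) - 1 ∈ 𝔭₁ ^ 3 ∨
      (ε : 𝓞 ↥(IntermediateField.adjoin ℚ ({β} : Set (AlgebraicClosure ℚ)))) + 1 ∈ 𝔭₁ ^ 3)
    (hnsq : ∀ y : (𝓞 ↥(IntermediateField.adjoin ℚ ({β} : Set (AlgebraicClosure ℚ))))ˣ, ε ≠ y ^ 2 ∧ ε ≠ -y ^ 2)
    (𝔭₂ : Ideal (𝓞 ↥(IntermediateField.adjoin ℚ ({β} : Set (AlgebraicClosure ℚ))))) [𝔭₂.IsPrime]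
    (h𝔭₂ : (2 : 𝓞 ↥(IntermediateField.adjoin ℚ ({β} : Set (AlgebraicClosure ℚ)))) ∈ 𝔭₂)
    {π : 𝓞 ↥(IntermediateField.adjoin ℚ ({β} : Set (AlgebraicClosure ℚ)))} {k : ℕ} (hk : 𝔭₂ ^ k = Ideal.span {π})
    (hπ : π - 3 ∈ 𝔭₁ ^ 3 ∨ π + 3 ∈ 𝔭₁ ^ 3)
    (κP : ZpExtension ↥(IntermediateField.adjoin ℚ ({β} : Set (AlgebraicClosure ℚ))) 2) (hκP : κP.IsCyclotomic) :
    classNumberPExp κP 1 = 1 := by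
  have hirr := AlignedTransportAtTwoSeed.irr_two_of_forall_not_hasRationalTwoTorsionX W ht
  have hβint : IsIntegral ℚ β := ((AlgebraicClosure.isAlgebraic ℚ).isAlgebraic β).isIntegral
  haveI : FiniteDimensional ℚ ↥(IntermediateField.adjoin ℚ ({β} : Set (AlgebraicClosure ℚ))) :=
    IntermediateField.adjoin.finiteDimensional hβint
  haveI : NumberField ↥(IntermediateField.adjoin ℚ ({β} : Set (AlgebraicClosure ℚ))) := NumberField.mk
  haveI : FiniteDimensional ↥(IntermediateField.adjoin ℚ ({β} : Set (AlgebraicClosure ℚ))) (κP.layer 1) :=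
    κP.finiteDimensional_layer_holds 1
  haveI : NumberField (κP.layer 1) := NumberField.of_module_finite ↥(IntermediateField.adjoin ℚ ({β} : Set (AlgebraicClosure ℚ))) _
  have h3 : Module.finrank ℚ ↥(IntermediateField.adjoin ℚ ({β} : Set (AlgebraicClosure ℚ))) = 3 :=
    AddKatoTwo.finrank_adjoin_root_twoTorsionPolynomial_eq_three W hirr hβ
  have hodd3 : ¬ 2 ∣ Module.finrank ℚ ↥(IntermediateField.adjoin ℚ ({β} : Set (AlgebraicClosure ℚ))) := by rw [h3]; decide
  have hodd : Odd (classNumber ↥(IntermediateField.adjoin ℚ ({β} : Set (AlgebraicClosure ℚ)))) :=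
    Nat.odd_iff.mpr (Nat.two_dvd_ne_zero.mp hh)
  -- unit rank `1` (`Δ_W < 0`: one real place)
  have hrank : Units.rank ↥(IntermediateField.adjoin ℚ ({β} : Set (AlgebraicClosure ℚ))) = 1 :=
    units_rank_eq_one_of_nrRealPlaces_eq_one _ h3 (nrRealPlaces_adjoin_root_twoTorsionPolynomial_eq_one W hΔ hirr hβ)
  -- exactly two primes above `2` (`Δ_min ≡ 5 (mod 8)`: off the Kilford stratum)
  have h8 : minimalDiscriminantInt W % 8 ≠ 1 := by rw [h85]; decide
  have hs := (not_onKilfordStratumAtTwo_iff_minimalDiscriminantInt_emod_eight_ne W hord).mpr h8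
  have h2 := ncard_eq_two_of_not_onKilfordStratumAtTwo ↥(IntermediateField.adjoin ℚ ({β} : Set (AlgebraicClosure ℚ))) W hord ht h3
    (AlignedTransportAtTwoCubicKilfordPrimes.aeval_four_mul_gen_twoDivisionUCubic W hβ) hs
  exact classNumberPExp_one_eq_one_of_genusCert_of_rank_eq_one hodd3 hd hodd hrank κP hκP h2.le 𝔭₁ hN hε hnsq 𝔭₂ h𝔭₂ hk hπ

/-! ## §2 The depth door with `e₁ ≤ 1` discharged -/

/-- **THE DEPTH DOOR ON `Δ_min ≡ 5 (mod 8)` WITH THE SEXTIC DATUM DISCHARGED.**  `W/ℚ` globally minimal, good ordinary at `2`, no rational `2`-torsion abscissa,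
`Δ_min ≡ 5 (mod 8)`, `Δ_W < 0`, `β` a root of the `2`-division cubic, `κ` a cyclotomic `ℤ₂`-extension of `ℚ(β)`; displayed: `h(ℚ(β))` odd, `2 ∤ d_{ℚ(β)}`, an ideal
`𝔭₁` of norm `2`, a unit `ε ≡ ±1 (mod 𝔭₁³)` with `±ε` non-squares, a prime `𝔭₂ ∋ 2` with `𝔭₂^k = (π)`, `π ≡ ±3 (mod 𝔭₁³)`, and the unit norm index
`[E_{ℚ(β)} : E_{ℚ(β)} ∩ N_{K_2/ℚ(β)} K_2ˣ] = 1` inside `K_2ˣ`.  THEN `rank₂ Cl(K_m) ≤ 1` for all `m`, `μ₂(κ) = 0`, `λ₂(κ) ≤ 1` (att-p3 g42's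
`classGroupPRank_le_one_adjoin_of_depthDoor_of_emod_four_eq_one` with `he1` supplied by §1). [cite: Washington1997, §13.3 Prop. 13.22–13.23]
[cite: Lang1990, Ch. 13 §4, Lemma 4.1 (PDF pp. 203–204)] [cite: Fukuda1994, Thm. 1, p. 264] [cite: Gras2003, IV.4] [cite: Serre1973CourseArithmetic, Ch. III §1.2, Thm. 1] -/
theorem classGroupPRank_le_one_adjoin_of_depthDoor_of_genusCert (hord : IsOrdinaryAt W 2)
    (ht : ∀ x : ℚ, ¬ HasRationalTwoTorsionX W x) (h85 : minimalDiscriminantInt W % 8 = 5) (hΔ : W.Δ < 0)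
    {β : AlgebraicClosure ℚ} (hβ : aeval β W.twoTorsionPolynomial.toPoly = 0)
    (hh : haveI : FiniteDimensional ℚ ↥(IntermediateField.adjoin ℚ ({β} : Set (AlgebraicClosure ℚ))) :=
        IntermediateField.adjoin.finiteDimensional ((AlgebraicClosure.isAlgebraic ℚ).isAlgebraic β).isIntegral
      haveI : NumberField ↥(IntermediateField.adjoin ℚ ({β} : Set (AlgebraicClosure ℚ))) := NumberField.mk
      ¬ 2 ∣ classNumber ↥(IntermediateField.adjoin ℚ ({β} : Set (AlgebraicClosure ℚ))))
    (hd : haveI : FiniteDimensional ℚ ↥(IntermediateField.adjoin ℚ ({β} : Set (AlgebraicClosure ℚ))) :=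
        IntermediateField.adjoin.finiteDimensional ((AlgebraicClosure.isAlgebraic ℚ).isAlgebraic β).isIntegral
      haveI : NumberField ↥(IntermediateField.adjoin ℚ ({β} : Set (AlgebraicClosure ℚ))) := NumberField.mk
      ¬ (2 : ℤ) ∣ NumberField.discr ↥(IntermediateField.adjoin ℚ ({β} : Set (AlgebraicClosure ℚ))))
    (𝔭₁ : Ideal (𝓞 ↥(IntermediateField.adjoin ℚ ({β} : Set (AlgebraicClosure ℚ)))))
    (hN : haveI : FiniteDimensional ℚ ↥(IntermediateField.adjoin ℚ ({β} : Set (AlgebraicClosure ℚ))) :=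
        IntermediateField.adjoin.finiteDimensional ((AlgebraicClosure.isAlgebraic ℚ).isAlgebraic β).isIntegral
      haveI : NumberField ↥(IntermediateField.adjoin ℚ ({β} : Set (AlgebraicClosure ℚ))) := NumberField.mk
      Ideal.absNorm 𝔭₁ = 2)
    {ε : (𝓞 ↥(IntermediateField.adjoin ℚ ({β} : Set (AlgebraicClosure ℚ))))ˣ}
    (hε : (ε : 𝓞 ↥(IntermediateField.adjoin ℚ ({β} : Set (AlgebraicClosure ℚ)))) - 1 ∈ 𝔭₁ ^ 3 ∨
      (ε : 𝓞 ↥(IntermediateField.adjoin ℚ ({β} : Set (AlgebraicClosure ℚ)))) + 1 ∈ 𝔭₁ ^ 3)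
    (hnsq : ∀ y : (𝓞 ↥(IntermediateField.adjoin ℚ ({β} : Set (AlgebraicClosure ℚ))))ˣ, ε ≠ y ^ 2 ∧ ε ≠ -y ^ 2)
    (𝔭₂ : Ideal (𝓞 ↥(IntermediateField.adjoin ℚ ({β} : Set (AlgebraicClosure ℚ))))) [𝔭₂.IsPrime]
    (h𝔭₂ : (2 : 𝓞 ↥(IntermediateField.adjoin ℚ ({β} : Set (AlgebraicClosure ℚ)))) ∈ 𝔭₂)
    {π : 𝓞 ↥(IntermediateField.adjoin ℚ ({β} : Set (AlgebraicClosure ℚ)))} {k : ℕ} (hk : 𝔭₂ ^ k = Ideal.span {π})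
    (hπ : π - 3 ∈ 𝔭₁ ^ 3 ∨ π + 3 ∈ 𝔭₁ ^ 3)
    (κP : ZpExtension ↥(IntermediateField.adjoin ℚ ({β} : Set (AlgebraicClosure ℚ))) 2) (hκP : κP.IsCyclotomic)
    [FiniteDimensional ↥(IntermediateField.adjoin ℚ ({β} : Set (AlgebraicClosure ℚ))) (κP.layer 2)] [NumberField (κP.layer 2)]
    (hidx : (unitsE (κP.layer 2) ⊓ (⊤ : Subgroup (κP.layer 2)ˣ).map
        (Herbrand.norm ((κP.layer 2) ≃ₐ[↥(IntermediateField.adjoin ℚ ({β} : Set (AlgebraicClosure ℚ)))] (κP.layer 2)))).relIndex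
        (unitsE (κP.layer 2) ⊓ (unitsIncl ↥(IntermediateField.adjoin ℚ ({β} : Set (AlgebraicClosure ℚ))) (κP.layer 2)).range) = 1) :
    (∀ m : ℕ, classGroupPRank κP m ≤ 1) ∧ ClassicalMuVanishes κP ∧ classicalLambda κP ≤ 1 := by
  have h41 : minimalDiscriminantInt W % 4 = 1 := by omega
  have he1 := classNumberPExp_one_adjoin_eq_one_of_genusCert W hord ht h85 hΔ hβ hh hd 𝔭₁ hN hε hnsq 𝔭₂ h𝔭₂ hk hπ κP hκP
  exact classGroupPRank_le_one_adjoin_of_depthDoor_of_emod_four_eq_one W hord ht h41 hβ hh κP hκP he1.le hidx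

/-! ## §3 The door into `MC₂(W)` -/

/-- **THE DEPTH DOOR INTO `MC₂(W)` WITH THE SEXTIC DATUM DISCHARGED.**  PRINT⁵ {Kato 17.4 (1)(2) at `2` (`h17`), Greenberg 4.1 (`hGr`), period unit
(`hper`), modularity (`hmod`), GZK (`hGZK`)} + MuIneqʳ (`hI`, the registered stub VERBATIM) + the cell hypotheses (good ordinary at `2`, no rational `2`-torsion
abscissa, `Δ_W < 0`, `r_an = 0`, analytic `μ₂ = 0` on the even branch, `BSD₂(W)`) + `Δ_min ≡ 5 (mod 8)` + `β` a root of the `2`-division cubic + the displayed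
CUBIC-FIELD data: `h(ℚ(β))` odd, `2 ∤ d_{ℚ(β)}`, `𝔭₁` of norm `2`, a unit `ε ≡ ±1 (mod 𝔭₁³)` with `±ε` non-squares, a prime `𝔭₂ ∋ 2` with `𝔭₂^k = (π)`,
`π ≡ ±3 (mod 𝔭₁³)` + for every cyclotomic `ℤ₂`-extension `κ` of `ℚ(β)` the unit norm index `[E_{ℚ(β)} : E_{ℚ(β)} ∩ N_{K_2/ℚ(β)} K_2ˣ] = 1` ⟹ `MC₂(W)`
(att-p3 g42's `mazurMainConjecture_two_of_muIneqRel_of_depthDoor_of_emod_four_eq_one` ∘ §1). [cite: Fukuda1994, Thm. 1, p. 264]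
[cite: Kato2004Asterisque, Thm. 17.4 (1)(2) (p. 273)] [cite: GreenbergLNM1716, Thm. 4.1 (p. 102) and Conj. 1.11 (p. 58)] [cite: Gras2003, IV.4]
[cite: Lang1990, Ch. 13 §4, Lemma 4.1 (PDF pp. 203–204)] [cite: Washington1997, §13.3 Prop. 13.22–13.23] -/
theorem mazurMainConjecture_two_of_muIneqRel_of_depthDoor_of_genusCert
    (h17 : ∀ [NeZero (W.conductorNorm ℤ)] (f : CuspForm (Gamma0 (W.conductorNorm ℤ)) 2),
      kato_divisibility_allPrimes W 2 (f := f))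
    (hGr : Greenberg1999.thm41_charValue_rankZero_anyPrime)
    (hper : realPeriodRat_eq_unit_mul_plusPeriod_two) (hmod : nonempty_modularParametrizationData)
    (hGZK : rank_eq_analyticRank_of_analyticRank_le_one)
    (hI : ∀ (W : WeierstrassCurve ℚ) [W.IsElliptic] [W.IsGloballyMinimal], IsOrdinaryAt W 2 →
      (∀ x : ℚ, ¬ HasRationalTwoTorsionX W x) →
      ∀ (κ : ZpExtension ℚ 2) (γ : Field.absoluteGaloisGroup ℚ), κ.IsCyclotomic →
      κ.IsTopGenerator γ → IsCyclotomicVariable 2 γ →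
      ∀ ⦃N : ℕ⦄ [NeZero N] (f : CuspForm (Gamma0 N) 2), IsNewformOf W f →
      ∀ Gp : IwasawaAlgebra 2, iwasawaToPowerSeries 2 Gp = padicLFunction f (unitRoot W 2 : ℚ_[2]) →
      ∀ (D : W.SelmerDualData κ γ) (Yr : W.FineSelmerDualDataRelaxedInf κ γ),
        lengthAt (IwasawaAlgebra 2) D.X ⟨IwasawaAlgebra.augIdealP 2, IwasawaAlgebra.isPrime_augIdealP_holds 2⟩ ≤
          lengthAt (IwasawaAlgebra 2) (IwasawaAlgebra 2 ⧸ Ideal.span {Gp})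
              ⟨IwasawaAlgebra.augIdealP 2, IwasawaAlgebra.isPrime_augIdealP_holds 2⟩ +
            lengthAt (IwasawaAlgebra 2) Yr.X ⟨IwasawaAlgebra.augIdealP 2, IwasawaAlgebra.isPrime_augIdealP_holds 2⟩)
    (hord : IsOrdinaryAt W 2) (ht : ∀ x : ℚ, ¬ HasRationalTwoTorsionX W x) (hΔ : W.Δ < 0) (hr : W.analyticRank = 0)
    (hμan : ∀ ⦃N : ℕ⦄ [NeZero N] (f : CuspForm (Gamma0 N) 2), IsNewformOf W f →
      ∀ G : IwasawaAlgebra 2, IsEvenBranchLiftAtTwo W f G → red G ≠ 0)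
    (hbsd : BSDp W 2) (h85 : minimalDiscriminantInt W % 8 = 5)
    {β : AlgebraicClosure ℚ} (hβ : aeval β W.twoTorsionPolynomial.toPoly = 0)
    (hh : haveI : FiniteDimensional ℚ ↥(IntermediateField.adjoin ℚ ({β} : Set (AlgebraicClosure ℚ))) :=
        IntermediateField.adjoin.finiteDimensional ((AlgebraicClosure.isAlgebraic ℚ).isAlgebraic β).isIntegral
      haveI : NumberField ↥(IntermediateField.adjoin ℚ ({β} : Set (AlgebraicClosure ℚ))) := NumberField.mk
      ¬ 2 ∣ classNumber ↥(IntermediateField.adjoin ℚ ({β} : Set (AlgebraicClosure ℚ))))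
    (hd : haveI : FiniteDimensional ℚ ↥(IntermediateField.adjoin ℚ ({β} : Set (AlgebraicClosure ℚ))) :=
        IntermediateField.adjoin.finiteDimensional ((AlgebraicClosure.isAlgebraic ℚ).isAlgebraic β).isIntegral
      haveI : NumberField ↥(IntermediateField.adjoin ℚ ({β} : Set (AlgebraicClosure ℚ))) := NumberField.mk
      ¬ (2 : ℤ) ∣ NumberField.discr ↥(IntermediateField.adjoin ℚ ({β} : Set (AlgebraicClosure ℚ))))
    (𝔭₁ : Ideal (𝓞 ↥(IntermediateField.adjoin ℚ ({β} : Set (AlgebraicClosure ℚ)))))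
    (hN : haveI : FiniteDimensional ℚ ↥(IntermediateField.adjoin ℚ ({β} : Set (AlgebraicClosure ℚ))) :=
        IntermediateField.adjoin.finiteDimensional ((AlgebraicClosure.isAlgebraic ℚ).isAlgebraic β).isIntegral
      haveI : NumberField ↥(IntermediateField.adjoin ℚ ({β} : Set (AlgebraicClosure ℚ))) := NumberField.mk
      Ideal.absNorm 𝔭₁ = 2)
    {ε : (𝓞 ↥(IntermediateField.adjoin ℚ ({β} : Set (AlgebraicClosure ℚ))))ˣ}
    (hε : (ε : 𝓞 ↥(IntermediateField.adjoin ℚ ({β} : Set (AlgebraicClosure ℚ)))) - 1 ∈ 𝔭₁ ^ 3 ∨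
      (ε : 𝓞 ↥(IntermediateField.adjoin ℚ ({β} : Set (AlgebraicClosure ℚ)))) + 1 ∈ 𝔭₁ ^ 3)
    (hnsq : ∀ y : (𝓞 ↥(IntermediateField.adjoin ℚ ({β} : Set (AlgebraicClosure ℚ))))ˣ, ε ≠ y ^ 2 ∧ ε ≠ -y ^ 2)
    (𝔭₂ : Ideal (𝓞 ↥(IntermediateField.adjoin ℚ ({β} : Set (AlgebraicClosure ℚ))))) [𝔭₂.IsPrime]
    (h𝔭₂ : (2 : 𝓞 ↥(IntermediateField.adjoin ℚ ({β} : Set (AlgebraicClosure ℚ)))) ∈ 𝔭₂)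
    {π : 𝓞 ↥(IntermediateField.adjoin ℚ ({β} : Set (AlgebraicClosure ℚ)))} {k : ℕ} (hk : 𝔭₂ ^ k = Ideal.span {π})
    (hπ : π - 3 ∈ 𝔭₁ ^ 3 ∨ π + 3 ∈ 𝔭₁ ^ 3)
    (hidx : ∀ (κP : ZpExtension ↥(IntermediateField.adjoin ℚ ({β} : Set (AlgebraicClosure ℚ))) 2)
      [FiniteDimensional ↥(IntermediateField.adjoin ℚ ({β} : Set (AlgebraicClosure ℚ))) (κP.layer 2)] [NumberField (κP.layer 2)],
      κP.IsCyclotomic →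
        (unitsE (κP.layer 2) ⊓ (⊤ : Subgroup (κP.layer 2)ˣ).map
            (Herbrand.norm ((κP.layer 2) ≃ₐ[↥(IntermediateField.adjoin ℚ ({β} : Set (AlgebraicClosure ℚ)))] (κP.layer 2)))).relIndex
          (unitsE (κP.layer 2) ⊓ (unitsIncl ↥(IntermediateField.adjoin ℚ ({β} : Set (AlgebraicClosure ℚ))) (κP.layer 2)).range) = 1) :
    MazurMainConjecture W 2 := by
  have h41 : minimalDiscriminantInt W % 4 = 1 := by omega
  refine mazurMainConjecture_two_of_muIneqRel_of_depthDoor_of_emod_four_eq_one W h17 hGr hper hmod hGZK hI hord ht hΔ hr hμan hbsd h41 hβ hh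
    fun κP _ _ hκP => ⟨?_, hidx κP hκP⟩
  exact (classNumberPExp_one_adjoin_eq_one_of_genusCert W hord ht h85 hΔ hβ hh hd 𝔭₁ hN hε hnsq 𝔭₂ h𝔭₂ hk hπ κP hκP).le

/-! ## §4 The ODD certificate (appended by the same seat): `e₁ = 1` and the depth door from `x² − 2y² = uα²`, `(α,x) = (α,2) = 1`, `α ≡ ±3 (mod 𝔭₁³)`

In the genus regime where `𝔓₂` is principal (the fundamental unit of `ℚ(β)` is not the norm of a unit of `ℚ(β,√2)`) the `𝔭₂`-certificate of §1 never fires;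
this seat's Literature theorem `classNumberPExp_one_eq_one_of_genusCert_odd_of_rank_eq_one` uses instead the ideal `(x + y√2, α)`.  Census instance
(numerics only, NOT asserted here): the rank-`0` seed `[1,−1,1,−3,−2]` (`Δ_min = −1259`) has such a certificate with `N(α) = ±7`, so `e₁ = 1` there. -/

/-- **`e₁(κ) = 1` FOR THE CUBIC `2`-TORSION FIELD FROM THE ODD GENUS CERTIFICATE.**  As `classNumberPExp_one_adjoin_eq_one_of_genusCert`, with the dyadic
datum `𝔭₂^k = (π)`, `π ≡ ±3` replaced by `x, y, α, m, n, m', n' ∈ 𝓞_{ℚ(β)}`, a unit `u`, with `x² − 2y² = u·α²`, `mα + nx = 1`, `m'α² + 2n' = 1`, `α ≡ ±3 (mod 𝔭₁³)`.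
[cite: Gras2003, IV.4] [cite: Serre1973CourseArithmetic, Ch. III §1.2, Thm. 1] [cite: NeukirchANT1999, Ch. I §3, §7 Thm. (7.4), Ch. III §1 (1.6)] [cite: Cohen1993, Prop. 4.8.11] -/
theorem classNumberPExp_one_adjoin_eq_one_of_genusCert_odd (hord : IsOrdinaryAt W 2)
    (ht : ∀ x : ℚ, ¬ HasRationalTwoTorsionX W x) (h85 : minimalDiscriminantInt W % 8 = 5) (hΔ : W.Δ < 0)
    {β : AlgebraicClosure ℚ} (hβ : aeval β W.twoTorsionPolynomial.toPoly = 0)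
    (hh : haveI : FiniteDimensional ℚ ↥(IntermediateField.adjoin ℚ ({β} : Set (AlgebraicClosure ℚ))) :=
        IntermediateField.adjoin.finiteDimensional ((AlgebraicClosure.isAlgebraic ℚ).isAlgebraic β).isIntegral
      haveI : NumberField ↥(IntermediateField.adjoin ℚ ({β} : Set (AlgebraicClosure ℚ))) := NumberField.mk
      ¬ 2 ∣ classNumber ↥(IntermediateField.adjoin ℚ ({β} : Set (AlgebraicClosure ℚ))))
    (hd : haveI : FiniteDimensional ℚ ↥(IntermediateField.adjoin ℚ ({β} : Set (AlgebraicClosure ℚ))) :=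
        IntermediateField.adjoin.finiteDimensional ((AlgebraicClosure.isAlgebraic ℚ).isAlgebraic β).isIntegral
      haveI : NumberField ↥(IntermediateField.adjoin ℚ ({β} : Set (AlgebraicClosure ℚ))) := NumberField.mk
      ¬ (2 : ℤ) ∣ NumberField.discr ↥(IntermediateField.adjoin ℚ ({β} : Set (AlgebraicClosure ℚ))))
    (𝔭₁ : Ideal (𝓞 ↥(IntermediateField.adjoin ℚ ({β} : Set (AlgebraicClosure ℚ)))))
    (hN : haveI : FiniteDimensional ℚ ↥(IntermediateField.adjoin ℚ ({β} : Set (AlgebraicClosure ℚ))) :=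
        IntermediateField.adjoin.finiteDimensional ((AlgebraicClosure.isAlgebraic ℚ).isAlgebraic β).isIntegral
      haveI : NumberField ↥(IntermediateField.adjoin ℚ ({β} : Set (AlgebraicClosure ℚ))) := NumberField.mk
      Ideal.absNorm 𝔭₁ = 2)
    {ε : (𝓞 ↥(IntermediateField.adjoin ℚ ({β} : Set (AlgebraicClosure ℚ))))ˣ}
    (hε : (ε : 𝓞 ↥(IntermediateField.adjoin ℚ ({β} : Set (AlgebraicClosure ℚ)))) - 1 ∈ 𝔭₁ ^ 3 ∨ (ε : 𝓞 ↥(IntermediateField.adjoin ℚ ({β} : Set (AlgebraicClosure ℚ)))) + 1 ∈ 𝔭₁ ^ 3)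
    (hnsq : ∀ z : (𝓞 ↥(IntermediateField.adjoin ℚ ({β} : Set (AlgebraicClosure ℚ))))ˣ, ε ≠ z ^ 2 ∧ ε ≠ -z ^ 2)
    {x y α m n m' n' : 𝓞 ↥(IntermediateField.adjoin ℚ ({β} : Set (AlgebraicClosure ℚ)))} {u : (𝓞 ↥(IntermediateField.adjoin ℚ ({β} : Set (AlgebraicClosure ℚ))))ˣ}
    (hxy : x ^ 2 - 2 * y ^ 2 = (u : 𝓞 ↥(IntermediateField.adjoin ℚ ({β} : Set (AlgebraicClosure ℚ)))) * α ^ 2) (hbez : m * α + n * x = 1) (hbez' : m' * α ^ 2 + n' * 2 = 1)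
    (hα : α - 3 ∈ 𝔭₁ ^ 3 ∨ α + 3 ∈ 𝔭₁ ^ 3)
    (κP : ZpExtension ↥(IntermediateField.adjoin ℚ ({β} : Set (AlgebraicClosure ℚ))) 2) (hκP : κP.IsCyclotomic) :
    classNumberPExp κP 1 = 1 := by
  have hirr := AlignedTransportAtTwoSeed.irr_two_of_forall_not_hasRationalTwoTorsionX W ht
  have hβint : IsIntegral ℚ β := ((AlgebraicClosure.isAlgebraic ℚ).isAlgebraic β).isIntegral
  haveI : FiniteDimensional ℚ ↥(IntermediateField.adjoin ℚ ({β} : Set (AlgebraicClosure ℚ))) := IntermediateField.adjoin.finiteDimensional hβint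
  haveI : NumberField ↥(IntermediateField.adjoin ℚ ({β} : Set (AlgebraicClosure ℚ))) := NumberField.mk
  haveI : FiniteDimensional ↥(IntermediateField.adjoin ℚ ({β} : Set (AlgebraicClosure ℚ))) (κP.layer 1) := κP.finiteDimensional_layer_holds 1
  haveI : NumberField (κP.layer 1) := NumberField.of_module_finite ↥(IntermediateField.adjoin ℚ ({β} : Set (AlgebraicClosure ℚ))) _
  have h3 : Module.finrank ℚ ↥(IntermediateField.adjoin ℚ ({β} : Set (AlgebraicClosure ℚ))) = 3 := AddKatoTwo.finrank_adjoin_root_twoTorsionPolynomial_eq_three W hirr hβ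
  have hodd3 : ¬ 2 ∣ Module.finrank ℚ ↥(IntermediateField.adjoin ℚ ({β} : Set (AlgebraicClosure ℚ))) := by rw [h3]; decide
  have hodd : Odd (classNumber ↥(IntermediateField.adjoin ℚ ({β} : Set (AlgebraicClosure ℚ)))) := Nat.odd_iff.mpr (Nat.two_dvd_ne_zero.mp hh)
  have hrank : Units.rank ↥(IntermediateField.adjoin ℚ ({β} : Set (AlgebraicClosure ℚ))) = 1 :=
    units_rank_eq_one_of_nrRealPlaces_eq_one _ h3 (nrRealPlaces_adjoin_root_twoTorsionPolynomial_eq_one W hΔ hirr hβ)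
  have h8 : minimalDiscriminantInt W % 8 ≠ 1 := by rw [h85]; decide
  have hs := (not_onKilfordStratumAtTwo_iff_minimalDiscriminantInt_emod_eight_ne W hord).mpr h8
  have h2 := ncard_eq_two_of_not_onKilfordStratumAtTwo ↥(IntermediateField.adjoin ℚ ({β} : Set (AlgebraicClosure ℚ))) W hord ht h3
    (AlignedTransportAtTwoCubicKilfordPrimes.aeval_four_mul_gen_twoDivisionUCubic W hβ) hs
  exact classNumberPExp_one_eq_one_of_genusCert_odd_of_rank_eq_one hodd3 hd hodd hrank κP hκP h2.le 𝔭₁ hN hε hnsq hxy hbez hbez' hα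

/-- **THE DEPTH DOOR ON `Δ_min ≡ 5 (mod 8)` FROM THE ODD CERTIFICATE** (`e₁ ≤ 1` discharged by §4's certificate; `hidx` displayed). [cite: Washington1997, §13.3 Prop. 13.22–13.23]
[cite: Lang1990, Ch. 13 §4, Lemma 4.1 (PDF pp. 203–204)] [cite: Fukuda1994, Thm. 1, p. 264] [cite: Gras2003, IV.4] [cite: Serre1973CourseArithmetic, Ch. III §1.2, Thm. 1] -/
theorem classGroupPRank_le_one_adjoin_of_depthDoor_of_genusCert_odd (hord : IsOrdinaryAt W 2)
    (ht : ∀ x : ℚ, ¬ HasRationalTwoTorsionX W x) (h85 : minimalDiscriminantInt W % 8 = 5) (hΔ : W.Δ < 0)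
    {β : AlgebraicClosure ℚ} (hβ : aeval β W.twoTorsionPolynomial.toPoly = 0)
    (hh : haveI : FiniteDimensional ℚ ↥(IntermediateField.adjoin ℚ ({β} : Set (AlgebraicClosure ℚ))) :=
        IntermediateField.adjoin.finiteDimensional ((AlgebraicClosure.isAlgebraic ℚ).isAlgebraic β).isIntegral
      haveI : NumberField ↥(IntermediateField.adjoin ℚ ({β} : Set (AlgebraicClosure ℚ))) := NumberField.mk
      ¬ 2 ∣ classNumber ↥(IntermediateField.adjoin ℚ ({β} : Set (AlgebraicClosure ℚ))))
    (hd : haveI : FiniteDimensional ℚ ↥(IntermediateField.adjoin ℚ ({β} : Set (AlgebraicClosure ℚ))) :=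
        IntermediateField.adjoin.finiteDimensional ((AlgebraicClosure.isAlgebraic ℚ).isAlgebraic β).isIntegral
      haveI : NumberField ↥(IntermediateField.adjoin ℚ ({β} : Set (AlgebraicClosure ℚ))) := NumberField.mk
      ¬ (2 : ℤ) ∣ NumberField.discr ↥(IntermediateField.adjoin ℚ ({β} : Set (AlgebraicClosure ℚ))))
    (𝔭₁ : Ideal (𝓞 ↥(IntermediateField.adjoin ℚ ({β} : Set (AlgebraicClosure ℚ)))))
    (hN : haveI : FiniteDimensional ℚ ↥(IntermediateField.adjoin ℚ ({β} : Set (AlgebraicClosure ℚ))) :=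
        IntermediateField.adjoin.finiteDimensional ((AlgebraicClosure.isAlgebraic ℚ).isAlgebraic β).isIntegral
      haveI : NumberField ↥(IntermediateField.adjoin ℚ ({β} : Set (AlgebraicClosure ℚ))) := NumberField.mk
      Ideal.absNorm 𝔭₁ = 2)
    {ε : (𝓞 ↥(IntermediateField.adjoin ℚ ({β} : Set (AlgebraicClosure ℚ))))ˣ}
    (hε : (ε : 𝓞 ↥(IntermediateField.adjoin ℚ ({β} : Set (AlgebraicClosure ℚ)))) - 1 ∈ 𝔭₁ ^ 3 ∨ (ε : 𝓞 ↥(IntermediateField.adjoin ℚ ({β} : Set (AlgebraicClosure ℚ)))) + 1 ∈ 𝔭₁ ^ 3)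
    (hnsq : ∀ z : (𝓞 ↥(IntermediateField.adjoin ℚ ({β} : Set (AlgebraicClosure ℚ))))ˣ, ε ≠ z ^ 2 ∧ ε ≠ -z ^ 2)
    {x y α m n m' n' : 𝓞 ↥(IntermediateField.adjoin ℚ ({β} : Set (AlgebraicClosure ℚ)))} {u : (𝓞 ↥(IntermediateField.adjoin ℚ ({β} : Set (AlgebraicClosure ℚ))))ˣ}
    (hxy : x ^ 2 - 2 * y ^ 2 = (u : 𝓞 ↥(IntermediateField.adjoin ℚ ({β} : Set (AlgebraicClosure ℚ)))) * α ^ 2) (hbez : m * α + n * x = 1) (hbez' : m' * α ^ 2 + n' * 2 = 1)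
    (hα : α - 3 ∈ 𝔭₁ ^ 3 ∨ α + 3 ∈ 𝔭₁ ^ 3)
    (κP : ZpExtension ↥(IntermediateField.adjoin ℚ ({β} : Set (AlgebraicClosure ℚ))) 2) (hκP : κP.IsCyclotomic)
    [FiniteDimensional ↥(IntermediateField.adjoin ℚ ({β} : Set (AlgebraicClosure ℚ))) (κP.layer 2)] [NumberField (κP.layer 2)]
    (hidx : (unitsE (κP.layer 2) ⊓ (⊤ : Subgroup (κP.layer 2)ˣ).map
        (Herbrand.norm ((κP.layer 2) ≃ₐ[↥(IntermediateField.adjoin ℚ ({β} : Set (AlgebraicClosure ℚ)))] (κP.layer 2)))).relIndex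
        (unitsE (κP.layer 2) ⊓ (unitsIncl ↥(IntermediateField.adjoin ℚ ({β} : Set (AlgebraicClosure ℚ))) (κP.layer 2)).range) = 1) :
    (∀ m : ℕ, classGroupPRank κP m ≤ 1) ∧ ClassicalMuVanishes κP ∧ classicalLambda κP ≤ 1 := by
  have h41 : minimalDiscriminantInt W % 4 = 1 := by omega
  have he1 := classNumberPExp_one_adjoin_eq_one_of_genusCert_odd W hord ht h85 hΔ hβ hh hd 𝔭₁ hN hε hnsq hxy hbez hbez' hα κP hκP
  exact classGroupPRank_le_one_adjoin_of_depthDoor_of_emod_four_eq_one W hord ht h41 hβ hh κP hκP he1.le hidx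

end Summit.BirchSwinnertonDyer.BirchSwinnertonDyer.Theorems.AlignedTransportAtTwoCubicDepthDoorGenusCert

end
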